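import Summits.Ventures.Crystal3D.Theorems.StickyWulffConstantTextureLiminfHcpRunEnd
import Summits.Ventures.Crystal3D.Theorems.StickyWulffConstantGenericWallFloorExactOnly
import HarnessLib

/-!
# A close-packed dozen containing the glide star contains the forward in-plane slot (cf-p1 R41s (N1))
# (route `StickyWulffConstant`; lane T helper; continues `…TextureLiminfHcpRunEnd`)

HONEST FRAMING. Part of the venture `Summits/Ventures/Crystal3D` (cell `crystal3d-full`), helper for the
crux `TextureLiminf` (stmt-Ventures-19483) of `route-Ventures-StickyWulffConstant` — the «one finite check to
formalise» of cf-p1 g26's R41s typing note (N1) (INBOX 2026-08-28T05:35:39Z): «IsClosePackedDozenAt t N ∧ glideStar ⊆ N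
⇒ t + A h0 ∈ N».  Rung credit only; no crux moved.

In the cubic frame of a grain `A` (conventions of `…TextureLiminfHcpRunEnd`: hex180 = `slotSite 2`, hex120 =
`slotSite 6`, tri150↑ = `slotSite 8`, tri150↓ = `u↓ = ⅓·slotSite 8 − ⅔·slotSite 0 − ⅔·slotSite 4` (not a slot),
hex0 = `slotSite 1`):

* `hex0_mem_of_isClosePackedDozenAt_glideStar` — if `N` is a close-packed dozen at `t` (`IsClosePackedDozenAt t N`,
  the E1/E2 vocabulary of `…GenericWallFloorExactOnly`: an isometric image of the cuboctahedral OR the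
  anticuboctahedral unit pattern) containing the four glide-star balls `t + A·hex180`, `t + A·hex120`,
  `t + A·tri150↑`, `t + A·tri150↓`, then `t + A·hex0 ∈ N`.  (Only four of the five star balls are needed.)
  Proof: the three independent exact slots force `N` to be the full slot shell of `A` (which contains hex0) or a
  twin dozen of `(A, n)` with hex180, hex120, tri150↑ own-side (`fccDozen_eq_slots_of_three_independent` /
  `hcpDozen_twin_of_three_independent`, crystal3d-wulff-p2); in the twin case `⟪A·hex0, n⟫ = −⟪A·hex180, n⟫ ∈
  {0, √(2/3)}`: `0` puts hex0 in the dozen, `√(2/3)` makes tri150↓ a mirror site, which the slot arithmetic of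
  `…HcpRunEnd` (`glideDown_not_mem_fccSlots`, `slotSite_four_eq`) excludes.
* `not_isClosePackedDozenAt_contacts_of_hcpRunEnd` — hence at a run-end (`t + A·hex0 ∉ X`) whose glide-star balls
  are present, the contact set of `t` is NOT a close-packed dozen: a saturated run-end has a NON-EXACT cap, so
  the residue rule `two_unsaturated_of_not_closePacked` / `hcpRunEnd_two_unsaturated` applies with no `NEC(η)`
  hypothesis — cf-p1's reading (N1).

WHAT THIS IS NOT: not a charge, not a census row, not the stub of any crux; F-C1 not moved.
-/

noncomputable section

namespace Summit.Ventures.Crystal3D.Theorems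

open Summit.Ventures.Crystal3D Finset NearIdentity
open Literature.Geometry.DiscreteGeometry (fccKissingPattern hcpKissingPattern)
open scoped InnerProductSpace

variable {X : Finset (EuclideanSpace ℝ (Fin 3))}

/-- **(N1).**  A close-packed dozen at `t` containing the glide-star balls hex180, hex120, tri150↑, tri150↓ of the
grain `A` contains the forward in-plane slot hex0. -/
theorem hex0_mem_of_isClosePackedDozenAt_glideStar
    (A : EuclideanSpace ℝ (Fin 3) ≃ₗᵢ[ℝ] EuclideanSpace ℝ (Fin 3)) {t : EuclideanSpace ℝ (Fin 3)}
    {N : Finset (EuclideanSpace ℝ (Fin 3))} (hN : IsClosePackedDozenAt t N)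
    (haN : t + A (slotSite 2) ∈ N) (hbN : t + A (slotSite 6) ∈ N) (hcN : t + A (slotSite 8) ∈ N)
    (hdN : t + A ((1 / 3 : ℝ) • slotSite 8 - (2 / 3 : ℝ) • slotSite 0 - (2 / 3 : ℝ) • slotSite 4) ∈ N) :
    t + A (slotSite 1) ∈ N := by
  obtain ⟨B, hB⟩ := hN
  set s := Real.sqrt (2 / 3) with hs
  have hs0 : 0 < s := Real.sqrt_pos.2 (by norm_num)
  set u : EuclideanSpace ℝ (Fin 3) :=
    (1 / 3 : ℝ) • slotSite 8 - (2 / 3 : ℝ) • slotSite 0 - (2 / 3 : ℝ) • slotSite 4 with hu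
  have hind : LinearIndependent ℝ ![A (slotSite 2), A (slotSite 6), A (slotSite 8)] :=
    linearIndependent_map_triple A (linearIndependent_slotSite (by decide))
  have slotA : ∀ w ∈ fccSlots, A w ∈ A '' (↑fccSlots : Set (EuclideanSpace ℝ (Fin 3))) :=
    fun w hw => ⟨w, Finset.mem_coe.2 hw, rfl⟩
  -- membership in `N` ↔ membership of the relative vector in the pattern image
  have key : ∀ (P : Finset (EuclideanSpace ℝ (Fin 3))),
      (↑N : Set (EuclideanSpace ℝ (Fin 3))) = (fun p => B p + t) '' ↑P →
      ∀ v : EuclideanSpace ℝ (Fin 3), (t + v ∈ N ↔ v ∈ B '' (↑P : Set (EuclideanSpace ℝ (Fin 3)))) := by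
    intro P hP v
    constructor
    · intro hv
      have hv' : t + v ∈ (↑N : Set (EuclideanSpace ℝ (Fin 3))) := hv
      rw [hP] at hv'
      obtain ⟨p, hp, he⟩ := hv'
      refine ⟨p, hp, ?_⟩
      have := congrArg (fun z => z - t) he
      simpa using this
    · rintro ⟨p, hp, he⟩
      have : t + v ∈ (↑N : Set (EuclideanSpace ℝ (Fin 3))) := by
        rw [hP]; exact ⟨p, hp, by show B p + t = t + v; rw [he, add_comm]⟩
      exact this
  rcases hB with hP | hP
  · -- cuboctahedral: the dozen is the full slot shell of `A`
    have hEq := fccDozen_eq_slots_of_three_independent A B ((key _ hP _).1 haN) ((key _ hP _).1 hbN)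
      ((key _ hP _).1 hcN) (slotA _ (slotSite_mem 2)) (slotA _ (slotSite_mem 6)) (slotA _ (slotSite_mem 8)) hind
    exact (key _ hP _).2 (by rw [hEq]; exact slotA _ (slotSite_mem 1))
  · -- anticuboctahedral: a twin dozen of `(A, n)` with hex180, hex120, tri150↑ own-side
    obtain ⟨n, hn, hmenu, hD⟩ := hcpDozen_twin_of_three_independent A B ((key _ hP _).1 haN)
      ((key _ hP _).1 hbN) ((key _ hP _).1 hcN) (slotA _ (slotSite_mem 2)) (slotA _ (slotSite_mem 6))
      (slotA _ (slotSite_mem 8)) hind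
    have ha : ⟪A (slotSite 2), n⟫_ℝ ≤ 0 := (slot_mem_twinDozen_iff A hn hmenu hD (slotSite_mem 2)).1 ((key _ hP _).1 haN)
    have h1 : ⟪A (slotSite 1), n⟫_ℝ = -⟪A (slotSite 2), n⟫_ℝ := by
      rw [slotSite_one_eq_neg_two, map_neg, inner_neg_left]
    rcases hmenu _ (slotSite_mem 1) with h0 | hpos | hneg
    · exact (key _ hP _).2 ((slot_mem_twinDozen_iff A hn hmenu hD (slotSite_mem 1)).2 h0.le)
    · exfalso
      have ha' : ⟪A (slotSite 2), n⟫_ℝ = -s := by linarith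
      have hdD : A u ∈ B '' (↑hcpKissingPattern : Set (EuclideanSpace ℝ (Fin 3))) := (key _ hP _).1 hdN
      rw [hD] at hdD
      rcases hdD with ⟨w, ⟨hw, -⟩, he⟩ | ⟨w, ⟨hw, hlt⟩, he⟩
      · have he' : A w = A u := he
        have : w = u := A.injective he'
        exact glideDown_not_mem_fccSlots (by rw [← hu, ← this]; exact hw)
      · have he' : A w - (2 * ⟪A w, n⟫_ℝ) • n = A u := he
        have hw' : ⟪A w, n⟫_ℝ = -s := by
          rcases hmenu w hw with h | h | h
          · linarith
          · linarith
          · exact h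
        have hun : ⟪A u, n⟫_ℝ = s := by
          rw [← he', inner_sub_left, inner_smul_left, real_inner_self_eq_norm_sq, hn, hw']
          simp; ring
        have hexp : ⟪A u, n⟫_ℝ = (1 / 3) * ⟪A (slotSite 8), n⟫_ℝ - (2 / 3) * ⟪A (slotSite 0), n⟫_ℝ -
            (2 / 3) * (⟪A (slotSite 8), n⟫_ℝ - ⟪A (slotSite 2), n⟫_ℝ) := by
          rw [hu, map_sub, map_sub, map_smul, map_smul, map_smul, slotSite_four_eq, map_sub,
            inner_sub_left, inner_sub_left, inner_smul_left, inner_smul_left, inner_smul_left, inner_sub_left]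
          simp
        have hc8' : ⟪A (slotSite 8), n⟫_ℝ = 0 ∨ ⟪A (slotSite 8), n⟫_ℝ = -s := by
          rcases hmenu _ (slotSite_mem 8) with h | h | h
          · exact Or.inl h
          · have := (slot_mem_twinDozen_iff A hn hmenu hD (slotSite_mem 8)).1 ((key _ hP _).1 hcN); linarith
          · exact Or.inr h
        rcases hmenu _ (slotSite_mem 0) with h0' | h0' | h0' <;> rcases hc8' with h8 | h8 <;>
          · rw [hexp, h0', h8, ha'] at hun; nlinarith [hs0]
    · linarith

/-- **Corollary (N1).**  At a run-end (`t + A·hex0 ∉ X`) with the four glide-star balls present, the contact set of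
`t` is NOT a close-packed dozen — a saturated run-end has a non-exact cap. -/
theorem not_isClosePackedDozenAt_contacts_of_hcpRunEnd
    (A : EuclideanSpace ℝ (Fin 3) ≃ₗᵢ[ℝ] EuclideanSpace ℝ (Fin 3)) {t : EuclideanSpace ℝ (Fin 3)}
    (haX : t + A (slotSite 2) ∈ X) (hbX : t + A (slotSite 6) ∈ X) (hcX : t + A (slotSite 8) ∈ X)
    (hdX : t + A ((1 / 3 : ℝ) • slotSite 8 - (2 / 3 : ℝ) • slotSite 0 - (2 / 3 : ℝ) • slotSite 4) ∈ X)
    (hrun : t + A (slotSite 1) ∉ X) :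
    ¬ IsClosePackedDozenAt t (X.filter fun q => dist t q = 1) := by
  intro hN
  have hslot : ∀ k : Fin 12, t + A (slotSite k) ∈ X → t + A (slotSite k) ∈ X.filter fun q => dist t q = 1 := by
    intro k hk
    refine Finset.mem_filter.2 ⟨hk, ?_⟩
    rw [dist_self_add_right, LinearIsometryEquiv.norm_map, norm_eq_one_of_mem_fccSlots (slotSite_mem k)]
  have hd : t + A ((1 / 3 : ℝ) • slotSite 8 - (2 / 3 : ℝ) • slotSite 0 - (2 / 3 : ℝ) • slotSite 4) ∈
      X.filter fun q => dist t q = 1 := by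
    refine Finset.mem_filter.2 ⟨hdX, ?_⟩
    rw [dist_self_add_right, LinearIsometryEquiv.norm_map, norm_glideDown]
  have hmem := hex0_mem_of_isClosePackedDozenAt_glideStar A hN (hslot 2 haX) (hslot 6 hbX) (hslot 8 hcX) hd
  exact hrun (Finset.mem_filter.1 hmem).1

end Summit.Ventures.Crystal3D.Theorems

end
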